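import Summits.BirchSwinnertonDyer.BirchSwinnertonDyer.Theorems.SignedLowerHalvesSmallImageLowerHalfBothSignsRttD2J2DeltaKernel
import HarnessLib

/-!
# Route `SignedLowerHalves`, crux L `SmallImageLowerHalfBothSigns` (stmt-BirchSwinnertonDyer-23599), line `rtt_w3` v15 — E2, junction row J2,
# research half «δ₁», brick (δ-b2): THE WRONG-WAY MAP `r : ker Σ_{V'→U'} → Maps(G ⧸ V, M)`, `r ∘ (R_c − 1) = Σ_{V'→V}`
# (the finite-level shadow of `(γ₂ − 1)⁻¹ : (γ₂ − 1)·Λ₂ ⥲ Λ₂`)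

INPUTS hand `bsd-inputs-honda-p1` g24 under LEAD `cruxlead-stmt-BirchSwinnertonDyer-23599` g11 (v15 SPEC, stub B `stub_charRoadJunction_ns`, row J2; J2 socket p786107).
Generic continuous-representation theory (no number theory). Setting: `G` compact, `ρ : ContinuousRep G ℤ M` discrete and FINITE, normal subgroups `V' ≤ V` and
`V' ≤ U'` with `G ⧸ V'`, `G ⧸ V` finite, an element `c ∈ U'` such that the fibres of `G ⧸ V' → G ⧸ U'` are `⟨c̄⟩`-orbits (`hgen`) and `[V ⊓ U' : V'] • M = 0` (`hidx`).
Then (brick (δ-a)) `ker Σ_{V'→U'} = (R_c − 1)·Maps(G ⧸ V', M)` and `Σ_{V'→V}` kills `ker (R_c − 1) = π* Maps(G ⧸ U', M)`, so `Σ_{V'→V}` factors through `R_c − 1`: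
* §1 `ker_rTransSub_le_ker_coindFinSum`, `range_rTransSub_eq_sumKer`; ★★ `rHom … : ker Σ_{V'→U'} ⟶ Maps(G ⧸ V, M)` (a morphism of topological representations) with
  ★ `rHom_apply_sub` (`r ((R_c − 1) φ) = Σ_{V'→V} φ`) — in the `ℤ_p²`-tower (`V' = Gal(K̄/K̃_m)`, `U' = Gal(K̄/K^{(1)}_m)`, `V = Gal(K̄/K̃_n)`, `c = γ₂`,
  `[V ⊓ U' : V'] = p^{m-n} ≥ p^k`) this is the map through which the connecting class `δ₁(x) ∈ H²(G_S, ker Σ_m)` is read in `H²(K̃_n, X_k)`;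
* §2 its laws: `rTransHom_rHom_sub` (`(R_c − 1) ∘ r = Σ_{V'→V}` on `ker Σ'` — whence `H²(R_{γ₂} − 1) ∘ H²(r) ∘ δ₁ = 0`), `coindFinSum_rHom` (transitivity in the target),
  `rHom_kerMapSum` (transitivity in the source), `rHom_kerMapCoeff` (coefficient change), `rHom_kerMapRTrans` (commutes with `R_γ` when `γ̄ c̄ = c̄ γ̄`).
DEFINITIONS WITH BODIES + THEOREMS (`--supports stmt-BirchSwinnertonDyer-23599` helper); no named fact, no `sorry`, no instance; crux L, crux M, E2 and BSD remain OPEN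
and are proved for NO curve by any of this.
References: [SerreLocalFields1979] VII §5–§7; [NeukirchSchmidtWingberg2008] I §5 Cor. (1.5.7), I §6; [Brown1982] VI §3; [PerrinRiou1994Invent] §1.3 (descent of Iwasawa cohomology).
-/

set_option autoImplicit false
-- the Theorems namespace of this sub repeats the summit name by design (D-0017 nested layout)
set_option linter.dupNamespace false

noncomputable section

open CategoryTheory
open scoped Classical

universe u

namespace Summit.BirchSwinnertonDyer.BirchSwinnertonDyer.Theorems.SmallImageRttD2J2Delta

open Literature.NumberTheory.GaloisRepresentations

variable {G : Type u} [Group G] [TopologicalSpace G] [IsTopologicalGroup G] [CompactSpace G]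
variable {M : Type u} [AddCommGroup M] [TopologicalSpace M] [DiscreteTopology M] (ρ : ContinuousRep G ℤ M)

/-! ## §1 The factorisation of `Σ_{V'→V}` through `R_c − 1` -/

section WrongWay

variable {U' V' V : Subgroup G} (h' : V' ≤ U') (hVV : V' ≤ V) [V'.Normal] (c : G) [Fintype (G ⧸ V')]

/-- `R_c − 1` on `Maps(G ⧸ V', M)` as a `ℤ`-linear map. [cite: SerreLocalFields1979, VII §5] -/
def rTransSub : (G ⧸ V' → M) →ₗ[ℤ] (G ⧸ V' → M) :=
  (rTransHom ρ.toTopRep V' (c : G ⧸ V')).hom.toLinearMap - LinearMap.id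

omit [IsTopologicalGroup G] [CompactSpace G] [Fintype (G ⧸ V')] in
/-- `rTransSub φ = R_c φ − φ`. [cite: SerreLocalFields1979, VII §5] -/
@[simp] theorem rTransSub_apply (φ : coindFin.{0, u} ρ.toTopRep V') : rTransSub ρ c φ = (rTransHom ρ.toTopRep V' (c : G ⧸ V')).hom φ - φ := rfl

omit [IsTopologicalGroup G] [CompactSpace G] in
/-- **`ker (R_c − 1) ≤ ker Σ_{V'→V}`**: an `R_c`-invariant function is pulled back from `G ⧸ U'` (cyclic fibres, brick (δ-a)), and the long fibre sum of a
pulled-back function vanishes when `[V ⊓ U' : V'] • M = 0` (brick (δ-a)). [cite: NeukirchSchmidtWingberg2008, I §5 Cor. (1.5.7)] [cite: SerreLocalFields1979, VII §7] -/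
theorem ker_rTransSub_le_ker_coindFinSum [Fintype (G ⧸ (V ⊓ U'))]
    (hgen : ∀ y y' : G ⧸ V', Subgroup.quotientMapOfLE h' y = Subgroup.quotientMapOfLE h' y' → ∃ j : ℕ, y' = y * (c : G ⧸ V') ^ j)
    (hidx : ∀ x : M, (V'.subgroupOf (V ⊓ U')).index • x = 0) :
    LinearMap.ker (rTransSub ρ c) ≤ LinearMap.ker (coindFinSum ρ.toTopRep hVV).hom.toLinearMap := fun φ hφ => by
  have hφ' : (rTransHom ρ.toTopRep V' (c : G ⧸ V')).hom φ = φ := sub_eq_zero.mp hφ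
  obtain ⟨f, rfl⟩ := exists_coindFinRes_eq_of_rTransHom_eq ρ.toTopRep h' hgen φ hφ'
  have hW : V' ≤ V ⊓ U' := le_inf hVV h'
  show (coindFinSum ρ.toTopRep (hW.trans inf_le_left)).hom ((coindFinRes ρ.toTopRep (hW.trans inf_le_right)).hom f) = 0
  exact coindFinSum_coindFinRes_eq_zero_of_index_smul_eq_zero ρ.toTopRep hW inf_le_left inf_le_right (fun x => hidx x) f

omit [IsTopologicalGroup G] [CompactSpace G] in
/-- **`range (R_c − 1) = ker Σ_{V'→U'}`** for finite `M`, `c ∈ U'` and cyclic fibres (brick (δ-a), both inclusions). [cite: Brown1982, VI §3] [cite: SerreLocalFields1979, VII §5–§6] -/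
theorem range_rTransSub_eq_sumKer [Finite M] (hc : c ∈ U')
    (hgen : ∀ y y' : G ⧸ V', Subgroup.quotientMapOfLE h' y = Subgroup.quotientMapOfLE h' y' → ∃ j : ℕ, y' = y * (c : G ⧸ V') ^ j) :
    LinearMap.range (rTransSub ρ c) = sumKer ρ h' := by
  haveI : Finite (ρ.toTopRep : Type u) := ‹Finite M›
  refine le_antisymm ?_ fun ψ hψ => ?_
  · rintro _ ⟨φ, rfl⟩
    exact (mem_sumKer ρ h').2 (coindFinSum_rTransHom_sub_of_mem ρ.toTopRep h' hc φ)
  · obtain ⟨φ, hφ⟩ := exists_rTransHom_sub_eq_of_coindFinSum_eq_zero ρ.toTopRep h' hc hgen ψ ((mem_sumKer ρ h').1 hψ)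
    exact ⟨φ, hφ⟩

variable (hV' : IsOpen (V' : Set G)) [Finite M] [Fintype (G ⧸ (V ⊓ U'))]
  (hc : c ∈ U')
  (hgen : ∀ y y' : G ⧸ V', Subgroup.quotientMapOfLE h' y = Subgroup.quotientMapOfLE h' y' → ∃ j : ℕ, y' = y * (c : G ⧸ V') ^ j)
  (hidx : ∀ x : M, (V'.subgroupOf (V ⊓ U')).index • x = 0)

/-- The `ℤ`-linear map underlying the wrong-way map: `ker Σ' = range (R_c − 1) ≅ Maps(G ⧸ V', M) ⧸ ker (R_c − 1) —Σ_{V'→V}→ Maps(G ⧸ V, M)`.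
[cite: PerrinRiou1994Invent, §1.3] [cite: NeukirchSchmidtWingberg2008, I §5 Cor. (1.5.7)] -/
def rLin : sumKer ρ h' →ₗ[ℤ] (G ⧸ V → M) :=
  ((LinearMap.ker (rTransSub ρ c)).liftQ (coindFinSum ρ.toTopRep hVV).hom.toLinearMap
      (ker_rTransSub_le_ker_coindFinSum ρ h' hVV c hgen hidx)).comp
    ((rTransSub ρ c).quotKerEquivRange.symm.toLinearMap.comp
      (LinearEquiv.ofEq (sumKer ρ h') (LinearMap.range (rTransSub ρ c)) (range_rTransSub_eq_sumKer ρ h' c hc hgen).symm).toLinearMap)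

omit [IsTopologicalGroup G] [CompactSpace G] in
/-- ★ **`r ((R_c − 1) φ) = Σ_{V'→V} φ`** — the defining property of the wrong-way map. [cite: PerrinRiou1994Invent, §1.3] -/
theorem rLin_apply_sub (φ : G ⧸ V' → M) (hmem : rTransSub ρ c φ ∈ sumKer ρ h') :
    rLin ρ h' hVV c hc hgen hidx ⟨rTransSub ρ c φ, hmem⟩ = (coindFinSum ρ.toTopRep hVV).hom φ := by
  have hmem' : rTransSub ρ c φ ∈ LinearMap.range (rTransSub ρ c) := ⟨φ, rfl⟩
  show (LinearMap.ker (rTransSub ρ c)).liftQ (coindFinSum ρ.toTopRep hVV).hom.toLinearMap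
      (ker_rTransSub_le_ker_coindFinSum ρ h' hVV c hgen hidx)
      ((rTransSub ρ c).quotKerEquivRange.symm
        (LinearEquiv.ofEq (sumKer ρ h') (LinearMap.range (rTransSub ρ c)) (range_rTransSub_eq_sumKer ρ h' c hc hgen).symm
          ⟨rTransSub ρ c φ, hmem⟩)) = _
  have h1 : (LinearEquiv.ofEq (sumKer ρ h') (LinearMap.range (rTransSub ρ c)) (range_rTransSub_eq_sumKer ρ h' c hc hgen).symm)
      ⟨rTransSub ρ c φ, hmem⟩ = ⟨rTransSub ρ c φ, hmem'⟩ := rfl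
  rw [h1, LinearMap.quotKerEquivRange_symm_apply_image, Submodule.mkQ_apply, Submodule.liftQ_apply]
  rfl

omit [IsTopologicalGroup G] [CompactSpace G] [Fintype (G ⧸ (V ⊓ U'))] in
include hc hgen in
/-- Every element of `ker Σ'` is `(R_c − 1) φ` for some `φ`. [cite: Brown1982, VI §3] -/
theorem exists_rTransSub_eq (ψ : sumKer ρ h') : ∃ φ : G ⧸ V' → M, rTransSub ρ c φ = (ψ : G ⧸ V' → M) := by
  have hψ : (ψ : G ⧸ V' → M) ∈ LinearMap.range (rTransSub ρ c) := by
    rw [range_rTransSub_eq_sumKer ρ h' c hc hgen]; exact ψ.2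
  exact hψ

/-- ★★ **THE WRONG-WAY MAP `r : ker Σ_{V'→U'} ⟶ Maps(G ⧸ V, M)`** as a morphism of topological representations (equivariant because `R_c − 1` and `Σ_{V'→V}` are).
[cite: PerrinRiou1994Invent, §1.3 (descent of Iwasawa cohomology)] [cite: NeukirchSchmidtWingberg2008, I §5 Cor. (1.5.7), I §6] -/
def rHom : (kerRep ρ h' hV').toTopRep ⟶ coindFin.{0, u} ρ.toTopRep V :=
  TopRep.ofHom
    { toLinearMap := rLin ρ h' hVV c hc hgen hidx
      cont := continuous_of_discreteTopology
      isIntertwining' := fun g => by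
        refine ContinuousLinearMap.ext fun ψ => ?_
        obtain ⟨φ, hφ⟩ := exists_rTransSub_eq ρ h' c hc hgen ψ
        have hψ : ψ = ⟨rTransSub ρ c φ, hφ ▸ ψ.2⟩ := Subtype.ext hφ.symm
        have hg : ((kerRep ρ h' hV') g ψ : G ⧸ V' → M) = rTransSub ρ c ((coindFin.{0, u} ρ.toTopRep V').ρ g φ) := by
          rw [kerRep_apply_coe, ← hφ, rTransSub_apply, rTransSub_apply, map_sub, TopRep.hom_comm_apply]
        have hg' : (kerRep ρ h' hV') g ψ = ⟨rTransSub ρ c ((coindFin.{0, u} ρ.toTopRep V').ρ g φ), hg ▸ ((kerRep ρ h' hV') g ψ).2⟩ :=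
          Subtype.ext hg
        change rLin ρ h' hVV c hc hgen hidx ((kerRep ρ h' hV') g ψ) = (coindFin.{0, u} ρ.toTopRep V).ρ g (rLin ρ h' hVV c hc hgen hidx ψ)
        rw [hg', rLin_apply_sub, hψ, rLin_apply_sub, TopRep.hom_comm_apply] }

/-- ★ **`r ((R_c − 1) φ) = Σ_{V'→V} φ`.** [cite: PerrinRiou1994Invent, §1.3] -/
theorem rHom_apply_sub (φ : G ⧸ V' → M) (hmem : rTransSub ρ c φ ∈ sumKer ρ h') :
    (rHom ρ h' hVV c hV' hc hgen hidx).hom ⟨rTransSub ρ c φ, hmem⟩ = (coindFinSum ρ.toTopRep hVV).hom φ :=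
  rLin_apply_sub ρ h' hVV c hc hgen hidx φ hmem

/-- **`(R_c − 1)(r ψ) = Σ_{V'→V} ψ`** on `ker Σ'` (right translations commute with fibre sums). Consequence (brick (δ-c)): `H²(R_c − 1) ∘ H²(r) ∘ δ₁ = H²(Σ_{V'→V} ∘ ι) ∘ δ₁ = 0`.
[cite: SerreLocalFields1979, VII §5] [cite: PerrinRiou1994Invent, §1.3] -/
theorem rTransHom_rHom_sub [V.Normal] (ψ : sumKer ρ h') :
    (rTransHom ρ.toTopRep V (c : G ⧸ V)).hom ((rHom ρ h' hVV c hV' hc hgen hidx).hom ψ) - (rHom ρ h' hVV c hV' hc hgen hidx).hom ψ =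
      (coindFinSum ρ.toTopRep hVV).hom (ψ : G ⧸ V' → M) := by
  obtain ⟨φ, hφ⟩ := exists_rTransSub_eq ρ h' c hc hgen ψ
  have hψ : ψ = ⟨rTransSub ρ c φ, hφ ▸ ψ.2⟩ := Subtype.ext hφ.symm
  rw [hψ, rHom_apply_sub, ← coindFinSum_rTransHom, ← map_sub]
  rfl

end WrongWay

/-! ## §2 Transitivity and naturality of the wrong-way maps -/

section Laws

variable {U' V' V V₀ : Subgroup G} (h' : V' ≤ U') (hVV : V' ≤ V) (hV₀ : V ≤ V₀) [V'.Normal] (c : G)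
  [Fintype (G ⧸ V')] [Fintype (G ⧸ V)] [Fintype (G ⧸ (V ⊓ U'))] [Fintype (G ⧸ (V₀ ⊓ U'))]
  (hV' : IsOpen (V' : Set G)) [Finite M] (hc : c ∈ U')
  (hgen : ∀ y y' : G ⧸ V', Subgroup.quotientMapOfLE h' y = Subgroup.quotientMapOfLE h' y' → ∃ j : ℕ, y' = y * (c : G ⧸ V') ^ j)
  (hidx : ∀ x : M, (V'.subgroupOf (V ⊓ U')).index • x = 0) (hidx₀ : ∀ x : M, (V'.subgroupOf (V₀ ⊓ U')).index • x = 0)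

/-- **Transitivity in the target**: `Σ_{V→V₀} (r_{V'→V} ψ) = r_{V'→V₀} ψ`. [cite: NeukirchSchmidtWingberg2008, I §5 Prop. (1.5.3)] -/
theorem coindFinSum_rHom (ψ : sumKer ρ h') :
    (coindFinSum ρ.toTopRep hV₀).hom ((rHom ρ h' hVV c hV' hc hgen hidx).hom ψ) = (rHom ρ h' (hVV.trans hV₀) c hV' hc hgen hidx₀).hom ψ := by
  obtain ⟨φ, hφ⟩ := exists_rTransSub_eq ρ h' c hc hgen ψ
  have hψ : ψ = ⟨rTransSub ρ c φ, hφ ▸ ψ.2⟩ := Subtype.ext hφ.symm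
  rw [hψ, rHom_apply_sub, rHom_apply_sub, coindFinSum_coindFinSum]

end Laws

section LawsSource

variable {U'' V'' U' V' V : Subgroup G} (h'' : V'' ≤ U'') (h' : V' ≤ U') (hVV' : V'' ≤ V') (hUU' : U'' ≤ U') (hVV : V' ≤ V)
  [V''.Normal] [V'.Normal] (c : G)
  [Fintype (G ⧸ V'')] [Fintype (G ⧸ V')] [Fintype (G ⧸ (V ⊓ U'))] [Fintype (G ⧸ (V ⊓ U''))]
  (hV'' : IsOpen (V'' : Set G)) (hV' : IsOpen (V' : Set G)) [Finite M] (hc' : c ∈ U') (hc'' : c ∈ U'')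
  (hgen' : ∀ y y' : G ⧸ V', Subgroup.quotientMapOfLE h' y = Subgroup.quotientMapOfLE h' y' → ∃ j : ℕ, y' = y * (c : G ⧸ V') ^ j)
  (hgen'' : ∀ y y' : G ⧸ V'', Subgroup.quotientMapOfLE h'' y = Subgroup.quotientMapOfLE h'' y' → ∃ j : ℕ, y' = y * (c : G ⧸ V'') ^ j)
  (hidx' : ∀ x : M, (V'.subgroupOf (V ⊓ U')).index • x = 0) (hidx'' : ∀ x : M, (V''.subgroupOf (V ⊓ U'')).index • x = 0)

/-- **Transitivity in the source**: `r_{V'→V} (Σ_{V''→V'} ψ) = r_{V''→V} ψ` on `ker Σ''` (`Σ_{V''→V'} ∘ (R_c − 1) = (R_c − 1) ∘ Σ_{V''→V'}`).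
[cite: NeukirchSchmidtWingberg2008, I §5 Prop. (1.5.3), (1.3.3)] -/
theorem rHom_kerMapSum (ψ : sumKer ρ h'') :
    (rHom ρ h' hVV c hV' hc' hgen' hidx').hom ((kerMapSum ρ h' h'' hVV' hUU' hV' hV'').hom ψ) =
      (rHom ρ h'' (hVV'.trans hVV) c hV'' hc'' hgen'' hidx'').hom ψ := by
  obtain ⟨φ, hφ⟩ := exists_rTransSub_eq ρ h'' c hc'' hgen'' ψ
  have hψ : ψ = ⟨rTransSub ρ c φ, hφ ▸ ψ.2⟩ := Subtype.ext hφ.symm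
  have hval : ((kerMapSum ρ h' h'' hVV' hUU' hV' hV'').hom ψ : G ⧸ V' → M) = rTransSub ρ c ((coindFinSum ρ.toTopRep hVV').hom φ) := by
    rw [kerMapSum_apply_coe, ← hφ, rTransSub_apply, rTransSub_apply, map_sub, coindFinSum_rTransHom]
  have hval' : (kerMapSum ρ h' h'' hVV' hUU' hV' hV'').hom ψ =
      ⟨rTransSub ρ c ((coindFinSum ρ.toTopRep hVV').hom φ), hval ▸ ((kerMapSum ρ h' h'' hVV' hUU' hV' hV'').hom ψ).2⟩ := Subtype.ext hval
  rw [hval', rHom_apply_sub, hψ, rHom_apply_sub, coindFinSum_coindFinSum]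

end LawsSource

section LawsCoeff

variable {M' : Type u} [AddCommGroup M'] [TopologicalSpace M'] [DiscreteTopology M'] (ρ' : ContinuousRep G ℤ M') (f : ρ.toTopRep ⟶ ρ'.toTopRep)
  {U' V' V : Subgroup G} (h' : V' ≤ U') (hVV : V' ≤ V) [V'.Normal] (c : G)
  [Fintype (G ⧸ V')] [Fintype (G ⧸ (V ⊓ U'))] (hV' : IsOpen (V' : Set G)) [Finite M] [Finite M'] (hc : c ∈ U')
  (hgen : ∀ y y' : G ⧸ V', Subgroup.quotientMapOfLE h' y = Subgroup.quotientMapOfLE h' y' → ∃ j : ℕ, y' = y * (c : G ⧸ V') ^ j)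
  (hidx : ∀ x : M, (V'.subgroupOf (V ⊓ U')).index • x = 0) (hidx' : ∀ x : M', (V'.subgroupOf (V ⊓ U')).index • x = 0)

/-- **Naturality in the coefficients**: `r' (Maps(f) ψ) = Maps(f) (r ψ)` (coefficient maps commute with `R_c` and `Σ`). [cite: SerreLocalFields1979, VII §6] -/
theorem rHom_kerMapCoeff (ψ : sumKer ρ h') :
    (rHom ρ' h' hVV c hV' hc hgen hidx').hom ((kerMapCoeff ρ ρ' f h' hV').hom ψ) = (coindFinMap f V).hom ((rHom ρ h' hVV c hV' hc hgen hidx).hom ψ) := by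
  obtain ⟨φ, hφ⟩ := exists_rTransSub_eq ρ h' c hc hgen ψ
  have hψ : ψ = ⟨rTransSub ρ c φ, hφ ▸ ψ.2⟩ := Subtype.ext hφ.symm
  have hval : ((kerMapCoeff ρ ρ' f h' hV').hom ψ : G ⧸ V' → M') = rTransSub ρ' c ((coindFinMap f V').hom φ) := by
    rw [kerMapCoeff_apply_coe, ← hφ, rTransSub_apply, rTransSub_apply, map_sub, coindFinMap_rTransHom]
  have hval' : (kerMapCoeff ρ ρ' f h' hV').hom ψ = ⟨rTransSub ρ' c ((coindFinMap f V').hom φ), hval ▸ ((kerMapCoeff ρ ρ' f h' hV').hom ψ).2⟩ :=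
    Subtype.ext hval
  rw [hval', rHom_apply_sub, hψ, rHom_apply_sub, coindFinMap_coindFinSum]

end LawsCoeff

section LawsRTrans

variable {U' V' V : Subgroup G} (h' : V' ≤ U') (hVV : V' ≤ V) [U'.Normal] [V'.Normal] [V.Normal] (c : G)
  [Fintype (G ⧸ V')] [Fintype (G ⧸ (V ⊓ U'))] (hV' : IsOpen (V' : Set G)) [Finite M] (hc : c ∈ U')
  (hgen : ∀ y y' : G ⧸ V', Subgroup.quotientMapOfLE h' y = Subgroup.quotientMapOfLE h' y' → ∃ j : ℕ, y' = y * (c : G ⧸ V') ^ j)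
  (hidx : ∀ x : M, (V'.subgroupOf (V ⊓ U')).index • x = 0)

/-- **The wrong-way map commutes with `R_γ` whenever `γ̄ c̄ = c̄ γ̄` in `G ⧸ V'`** (e.g. `[γ, c] ∈ V'`): `r (R_γ ψ) = R_γ (r ψ)`. [cite: SerreLocalFields1979, VII §5] -/
theorem rHom_kerMapRTrans (γ : G) (hcomm : (γ : G ⧸ V') * (c : G ⧸ V') = (c : G ⧸ V') * (γ : G ⧸ V')) (ψ : sumKer ρ h') :
    (rHom ρ h' hVV c hV' hc hgen hidx).hom ((kerMapRTrans ρ h' hV' γ).hom ψ) =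
      (rTransHom ρ.toTopRep V (γ : G ⧸ V)).hom ((rHom ρ h' hVV c hV' hc hgen hidx).hom ψ) := by
  obtain ⟨φ, hφ⟩ := exists_rTransSub_eq ρ h' c hc hgen ψ
  have hψ : ψ = ⟨rTransSub ρ c φ, hφ ▸ ψ.2⟩ := Subtype.ext hφ.symm
  have hRR : ∀ χ : G ⧸ V' → M, (rTransHom ρ.toTopRep V' (γ : G ⧸ V')).hom ((rTransHom ρ.toTopRep V' (c : G ⧸ V')).hom χ) =
      (rTransHom ρ.toTopRep V' (c : G ⧸ V')).hom ((rTransHom ρ.toTopRep V' (γ : G ⧸ V')).hom χ) := fun χ => by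
    funext y
    simp only [rTransHom_apply, mul_assoc, hcomm]
  have hval : ((kerMapRTrans ρ h' hV' γ).hom ψ : G ⧸ V' → M) = rTransSub ρ c ((rTransHom ρ.toTopRep V' (γ : G ⧸ V')).hom φ) := by
    rw [kerMapRTrans_apply_coe, ← hφ, rTransSub_apply, rTransSub_apply, map_sub, hRR]
  have hval' : (kerMapRTrans ρ h' hV' γ).hom ψ = ⟨rTransSub ρ c ((rTransHom ρ.toTopRep V' (γ : G ⧸ V')).hom φ), hval ▸ ((kerMapRTrans ρ h' hV' γ).hom ψ).2⟩ :=
    Subtype.ext hval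
  rw [hval', rHom_apply_sub, hψ, rHom_apply_sub, coindFinSum_rTransHom]

end LawsRTrans

end Summit.BirchSwinnertonDyer.BirchSwinnertonDyer.Theorems.SmallImageRttD2J2Delta

end
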